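import Literature.NumberTheory.LFunctions.RodgersTaoHamiltonianProofs
import HarnessLib

/-!
# Rodgers–Tao 2020, Lemma 21 (i) — RH-FREE CONTENT twin: the `ψ_T`-weighted interaction energy
# `Σ_{j≠k} ψ_T(j)ψ_T(k) E_{jk}(t)` is «moderately sized», at EVERY time `t`

RH-FREE literature proofs (no definitions, no named facts, no `sorry`). Trunk T-ANT
(`Literature/NumberTheory/LFunctions`); companion of `RodgersTaoHamiltonian.lean` (the typed,
VACUOUS-AS-PRINTED / EX-FALSO fact `Literature.NumberTheory.LFunctions.rodgers_tao_moderatelySized`,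
Rodgers–Tao 2020 Lemma 21 = arXiv v4 Lemma 7.6, whose conjunct (i) this file proves WITH CONTENT)
and of `RodgersTaoHamiltonianProofs.lean` (the RH-FREE `ξ`-display
`rodgers_tao_truncWeight_xi_sq_sum_bound_holds` of the printed proof, FMP p. 48 first display).
C3 cell, CONTENT-TWIN programme (rt-lead standing ruling: content twins are 0-fact new modules).

> B. Rodgers, T. Tao, *The de Bruijn–Newman constant is non-negative*, Forum Math. Pi 8 (2020)
> e6 (= arXiv:1801.05914v4 §7), **Lemma 21 (i)** (FMP p. 47; v4 Lemma 7.6 (i), TeX l. 1213–1219):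
> "Let `t` be in the range `Λ/2 ≤ t ≤ 0`. (i) The quantity
> `Σ_{j,k ∈ ℤ^*: j ≠ k} ψ_T(j) ψ_T(k)/|x_j(t)-x_k(t)|^2` is moderately sized." — where (p. 47)
> "We call a (time-dependent) quantity *moderately sized* if it is of the form
> `O(T log^3_+ T + Ẽ_T(t))`"; proof (p. 47–48, v4 l. 1235–1240): "From (xidif) we see that
> `Σ_{k: k ≠ j} 1/|ξ_j-ξ_k|^2 ≪ log^2_+ j` for all `j ∈ ℤ^*`, and hence
> `Σ_{j,k: j ≠ k} ψ_T(j) ψ_T(k)/|ξ_j-ξ_k|^2 ≪ T log^3_+ T`. From this and Lemma 16 we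
> conclude (i)."

## What is proved, and the (shorter) road taken

The printed proof quotes Lemma 16 (the expansion `Ẽ = Σ(E − 1/|Δξ|²) + O(…)`, whose error term
comes from the location law (50)). For item (i) ONLY AN UPPER BOUND on `Σ ψψ E_{jk}` is needed, and
that follows from the POINTWISE inequality behind (62)–(63):
`V(u) = 1/u² − 1 + 2(|u| − 1) = 1/u² + 2|u| − 3 ≥ 1/u² − 3`, i.e. with `u = (x_k − x_j)/(ξ_k − ξ_j)`,

  `E_{jk}(t) = 1/(x_j − x_k)² ≤ Ẽ_{jk}(t) + 3/(ξ_j − ξ_k)²`   (`inv_sq_le_renormEnergyZ_add`),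

valid for EVERY real `t` and all `j ≠ k` in `ℤ*` (no location law, no hypothesis on `Λ`; the tree's
junk conventions `1/0 = 0` make it hold even at a coincidence `x_j(t) = x_k(t)`). Multiplying by
`ψ_T(j)ψ_T(k) ≥ 0` and summing with the RH-FREE `ξ`-display of the printed proof
(`rodgers_tao_truncWeight_xi_sq_sum_bound_holds`: `Σ_{j≠k} ψψ/(ξ_j − ξ_k)² ≤ C·T log³ T` for
`T ≥ T₁`) gives the main results (all `theorem`s, 0 new facts):

* `tsum_truncWeight_interactionEnergy_le` — HYPOTHESIS-FREE, every `t : ℝ`: there are `C ≥ 0`,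
  `T₁` such that for all `T ≥ T₁` and ALL real `t` with `Ẽ_T(t)` finite (summable), the family
  `(j,k) ↦ ψ_T(j)ψ_T(k)E_{jk}(t)` on the pairs `j ≠ k` in `ℤ*` is summable and
  `Σ_{j≠k} ψ_T(j)ψ_T(k) E_{jk}(t) ≤ Ẽ_T(t) + C·T·log³ T`;
* `isModeratelySized_truncWeight_interactionEnergy` — Lemma 21 (i) in the tree's
  `IsModeratelySized` rendering, for every `t₀` such that some time `t₁ < t₀/2` is real-rooted
  (so that on the window `t₀/2 ≤ t ≤ 0` the zeros are strictly increasing and `Ẽ_T(t) ≥ 0`;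
  this is the only place a hypothesis enters, and it enters only to make `T log³ T + Ẽ_T(t)` a
  legitimate majorant — for `Ẽ_T(t) < 0`, possible only at junk coincidences, no constant works);
* `rodgers_tao_moderatelySized_i_of_neg` — the printed witness form: for `t₀ < 0` with `H_{t₀}`
  real-rooted, conjunct (i) of `rodgers_tao_moderatelySized t₀` holds BY THIS ARGUMENT (a CONTENT
  proof of that conjunct; the tree's `rodgers_tao_moderatelySized_holds` proves all four conjuncts
  ex falso from `Λ ≥ 0`, which refutes the antecedent — that record is unchanged).

Not treated here (deliberately): item (ii) of Lemma 21 is the cell's erratum E-d / G-rt-13 (false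
as printed by a factor `log T`, module docstring of `RodgersTaoHamiltonian.lean`, «Possible gap in
print») and is not a twin target; items (iii)/(iv) and the `ξ`-clause are separate rows.

bears_on: N-C/N-P (COLUMN 3 DBN). WHAT THIS IS NOT: an elementary inequality between two
`ψ_T`-weighted sums over the real zeros of `H_t`, valid at every time — RH-free; the printed
`Λ/2 ≤ t ≤ 0` instance (conjunct (i) of `rodgers_tao_moderatelySized`) stays VACUOUS-AS-PRINTED as a
record; nothing here bears on the truth of RH.

## References

* B. Rodgers, T. Tao, Forum Math. Pi 8 (2020) e6, §7: Lemma 21 p. 47 and its proof pp. 47–48,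
  (62)–(63) p. 40, (66)–(67) p. 42 (= arXiv:1801.05914v4 Lemma 7.6, TeX l. 1213–1244).
-/

noncomputable section

open Set Filter Topology

namespace Literature.NumberTheory.LFunctions

/-! ### The pointwise inequality behind (62)–(63): `1/a² ≤ V(a/b)/b² + 3/b²` -/

/-- `V(u) ≥ 1/u² − 3` in the form used for (i): for `b ≠ 0` and any real `a`,
`1/a² ≤ V(a/b)/b² + 3/b²` (indeed `V(a/b)/b² + 3/b² = 1/a² + 2|a/b|/b²`; junk-safe at `a = 0`,
where both sides vanish). [cite: RodgersTaoFMP2020, §7 p. 40 (62)–(63)] -/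
theorem one_div_sq_le_renormPotential_div_add {a b : ℝ} (hb : b ≠ 0) :
    1 / a ^ 2 ≤ renormPotential (a / b) / b ^ 2 + 3 / b ^ 2 := by
  have hb2 : 0 < b ^ 2 := by positivity
  rcases eq_or_ne a 0 with rfl | ha
  · simp [renormPotential_eq_def]
    norm_num
    rw [← add_div]
    norm_num
  · have key : renormPotential (a / b) / b ^ 2 + 3 / b ^ 2 = 1 / a ^ 2 + 2 * |a / b| / b ^ 2 := by
      rw [renormPotential_eq_def, div_pow]
      field_simp
      ring
    rw [key]
    have : 0 ≤ 2 * |a / b| / b ^ 2 := by positivity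
    linarith

/-- The energy form: for EVERY real `t` and distinct `j, k ∈ ℤ` (in particular in `ℤ*`),
`E_{jk}(t) ≤ Ẽ_{jk}(t) + 3/(ξ_j − ξ_k)²`, where `E_{jk} = 1/(x_j − x_k)²` (58) is
`interactionEnergy` and `Ẽ_{jk} = V((x_k − x_j)/(ξ_k − ξ_j))/(ξ_k − ξ_j)²` is `renormEnergyZ`.
No hypothesis on `t` (junk-safe). [cite: RodgersTaoFMP2020, §7 p. 40 (62)–(63)] -/
theorem interactionEnergy_le_renormEnergyZ_add (t : ℝ) {j k : ℤ} (hjk : j ≠ k) :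
    interactionEnergy t j k ≤
      renormEnergyZ t j k + 3 / (classicalLocationZ j - classicalLocationZ k) ^ 2 := by
  have hξ : classicalLocationZ k - classicalLocationZ j ≠ 0 := classicalLocationZ_sub_ne_zero hjk
  have h := one_div_sq_le_renormPotential_div_add (a := deBruijnZeroZ t k - deBruijnZeroZ t j) hξ
  rw [interactionEnergy_eq, renormEnergyZ_eq]
  have h1 : (deBruijnZeroZ t j - deBruijnZeroZ t k) ^ 2 = (deBruijnZeroZ t k - deBruijnZeroZ t j) ^ 2 := by
    ring
  have h2 : (classicalLocationZ j - classicalLocationZ k) ^ 2 =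
      (classicalLocationZ k - classicalLocationZ j) ^ 2 := by ring
  rw [h1, h2]
  exact h

/-- The weighted form on the index type of (67): for `T log T > 0`, every real `t` and every pair
`p = (j,k)`, `j ≠ k` in `ℤ*`,
`ψ_T(j)ψ_T(k)E_{jk}(t) ≤ ψ_T(j)ψ_T(k)Ẽ_{jk}(t) + 3·ψ_T(j)ψ_T(k)/(ξ_j − ξ_k)²`, the first term on
the right being the summand `truncEnergyTerm T t p` of `Ẽ_T(t)`.
[cite: RodgersTaoFMP2020, §7 p. 42 (66)–(67), p. 40 (62)–(63)] -/
theorem truncWeight_mul_interactionEnergy_le {T : ℝ} (hT : 0 < T * Real.log T) (t : ℝ)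
    (p : zstarOffDiag) :
    truncWeight T p.1.1 * truncWeight T p.1.2 * interactionEnergy t p.1.1 p.1.2 ≤
      truncEnergyTerm T t p + 3 * (truncWeight T p.1.1 * truncWeight T p.1.2 /
        (classicalLocationZ p.1.1 - classicalLocationZ p.1.2) ^ 2) := by
  have hw : 0 ≤ truncWeight T p.1.1 * truncWeight T p.1.2 :=
    mul_nonneg (truncWeight_pos hT _).le (truncWeight_pos hT _).le
  have h := mul_le_mul_of_nonneg_left (interactionEnergy_le_renormEnergyZ_add t p.2.2.2) hw
  rw [truncEnergyTerm_eq]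
  calc truncWeight T p.1.1 * truncWeight T p.1.2 * interactionEnergy t p.1.1 p.1.2
      ≤ truncWeight T p.1.1 * truncWeight T p.1.2 *
          (renormEnergyZ t p.1.1 p.1.2 + 3 / (classicalLocationZ p.1.1 - classicalLocationZ p.1.2) ^ 2) := h
    _ = _ := by ring

/-- The weighted energy summand is non-negative (for `T log T > 0`; any `t`).
[cite: RodgersTaoFMP2020, §7 p. 42 (66), §4 p. 29 (58)] -/
theorem truncWeight_mul_interactionEnergy_nonneg {T : ℝ} (hT : 0 < T * Real.log T) (t : ℝ)
    (p : zstarOffDiag) :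
    0 ≤ truncWeight T p.1.1 * truncWeight T p.1.2 * interactionEnergy t p.1.1 p.1.2 :=
  mul_nonneg (mul_nonneg (truncWeight_pos hT _).le (truncWeight_pos hT _).le)
    (by rw [interactionEnergy_eq]; positivity)

/-! ### Lemma 21 (i), hypothesis-free form: `Σ ψψ E ≤ Ẽ_T(t) + C·T log³ T` at every time -/

/-- **Rodgers–Tao 2020, Lemma 21 (i) — RH-FREE CONTENT, hypothesis-free form.** There are `C ≥ 0`
and `T₁` such that for all `T ≥ T₁` and EVERY real `t` at which `Ẽ_T(t)` is finite (the family
(67) summable), the family `(j,k) ↦ ψ_T(j)ψ_T(k)E_{jk}(t)` on the pairs `j ≠ k` in `ℤ*` is summable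
and `Σ_{j≠k} ψ_T(j)ψ_T(k)E_{jk}(t) ≤ Ẽ_T(t) + C·T·log³ T`. Road: the pointwise
`truncWeight_mul_interactionEnergy_le` summed, with the `ξ`-display of the printed proof
(`rodgers_tao_truncWeight_xi_sq_sum_bound_holds`, FMP p. 48). No location law and no hypothesis on
`Λ` is used. [cite: RodgersTaoFMP2020, Lemma 21 (i) p. 47 (= arXiv:1801.05914v4 Lemma 7.6 (i))] -/
theorem tsum_truncWeight_interactionEnergy_le :
    ∃ C T₁ : ℝ, 0 ≤ C ∧ ∀ T : ℝ, T₁ ≤ T → ∀ t : ℝ, Summable (truncEnergyTerm T t) →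
      Summable (fun p : zstarOffDiag ↦
        truncWeight T p.1.1 * truncWeight T p.1.2 * interactionEnergy t p.1.1 p.1.2) ∧
      ∑' p : zstarOffDiag, truncWeight T p.1.1 * truncWeight T p.1.2 * interactionEnergy t p.1.1 p.1.2
        ≤ truncEnergy T t + C * (T * Real.log T ^ 3) := by
  obtain ⟨C, T₁, hC⟩ := rodgers_tao_truncWeight_xi_sq_sum_bound_holds
  refine ⟨max (3 * C) 0, max T₁ 2, le_max_right _ _, fun T hT t hs ↦ ?_⟩
  have hT₁ : T₁ ≤ T := le_trans (le_max_left _ _) hT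
  have hT2 : 2 ≤ T := le_trans (le_max_right _ _) hT
  have hlog : 0 < Real.log T := Real.log_pos (by linarith)
  have hTlog : 0 < T * Real.log T := mul_pos (by linarith) hlog
  obtain ⟨hsξ, hξ⟩ := hC T hT₁
  set F : zstarOffDiag → ℝ := fun p ↦ truncWeight T p.1.1 * truncWeight T p.1.2 /
    (classicalLocationZ p.1.1 - classicalLocationZ p.1.2) ^ 2 with hF
  set G : zstarOffDiag → ℝ := fun p ↦
    truncWeight T p.1.1 * truncWeight T p.1.2 * interactionEnergy t p.1.1 p.1.2 with hG
  have hmaj : Summable (fun p : zstarOffDiag ↦ truncEnergyTerm T t p + 3 * F p) :=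
    hs.add (hsξ.mul_left 3)
  have hle : ∀ p, G p ≤ truncEnergyTerm T t p + 3 * F p := fun p ↦
    truncWeight_mul_interactionEnergy_le hTlog t p
  have hnn : ∀ p, 0 ≤ G p := fun p ↦ truncWeight_mul_interactionEnergy_nonneg hTlog t p
  have hsG : Summable G := hmaj.of_nonneg_of_le hnn hle
  refine ⟨hsG, ?_⟩
  have h1 : ∑' p, G p ≤ ∑' p, (truncEnergyTerm T t p + 3 * F p) := hsG.tsum_le_tsum hle hmaj
  have h2 : ∑' p, (truncEnergyTerm T t p + 3 * F p) = truncEnergy T t + 3 * ∑' p, F p := by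
    rw [hs.tsum_add (hsξ.mul_left 3), tsum_mul_left, truncEnergy_eq]
  have hTL : 0 ≤ T * Real.log T ^ 3 := by positivity
  have h3 : 3 * ∑' p, F p ≤ max (3 * C) 0 * (T * Real.log T ^ 3) := by
    calc 3 * ∑' p, F p ≤ 3 * (C * (T * Real.log T ^ 3)) := by
          exact mul_le_mul_of_nonneg_left hξ (by norm_num)
      _ = 3 * C * (T * Real.log T ^ 3) := by ring
      _ ≤ max (3 * C) 0 * (T * Real.log T ^ 3) :=
          mul_le_mul_of_nonneg_right (le_max_left _ _) hTL
  linarith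

/-! ### Lemma 21 (i) in the `IsModeratelySized` rendering -/

/-- **Rodgers–Tao 2020, Lemma 21 (i) — RH-FREE CONTENT twin** in the tree's rendering of
«moderately sized» (`IsModeratelySized t₀`, i.e. `O(T log³ T + Ẽ_T(t))` for `T` large and
`t₀/2 ≤ t ≤ 0` with `Ẽ_T(t)` finite): `Σ_{j≠k} ψ_T(j)ψ_T(k)E_{jk}(t)` is moderately sized, for
every `t₀` whose window `[t₀/2, 0]` lies above a real-rooted time `t₁ < t₀/2` (the only use of
this hypothesis: the zeros are then strictly increasing on the window, so `Ẽ_T(t) ≥ 0` and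
`T log³ T + Ẽ_T(t)` is a legitimate majorant; the inequality itself is
`tsum_truncWeight_interactionEnergy_le`, valid at every time). House form of the printed
`Λ/2 ≤ t ≤ 0` (cell ruling R2: windows above a real-rooted time; nothing is asserted about `Λ`).
[cite: RodgersTaoFMP2020, Lemma 21 (i) p. 47 (= arXiv:1801.05914v4 Lemma 7.6 (i))] -/
theorem isModeratelySized_truncWeight_interactionEnergy {t₀ : ℝ}
    (hreal : ∃ t₁ : ℝ, t₁ < t₀ / 2 ∧ HasOnlyRealZeros (deBruijnH t₁)) :
    IsModeratelySized t₀ (fun T t p ↦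
      truncWeight T p.1.1 * truncWeight T p.1.2 * interactionEnergy t p.1.1 p.1.2) := by
  obtain ⟨C, T₁, hC0, hC⟩ := tsum_truncWeight_interactionEnergy_le
  obtain ⟨t₁, ht₁, hreal₁⟩ := hreal
  refine ⟨1 + C, max T₁ 2, fun T hT t ht _ hs ↦ ?_⟩
  have hT₁ : T₁ ≤ T := le_trans (le_max_left _ _) hT
  have hT2 : 2 ≤ T := le_trans (le_max_right _ _) hT
  have hlog : 0 < Real.log T := Real.log_pos (by linarith)
  have hTlog : 0 < T * Real.log T := mul_pos (by linarith) hlog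
  obtain ⟨hsG, hG⟩ := hC T hT₁ t hs
  refine ⟨hsG, ?_⟩
  have hmono : StrictMono (deBruijnZeroZ t) :=
    strictMono_deBruijnZeroZ ⟨t₁, by linarith, hreal₁⟩
  have hE : 0 ≤ truncEnergy T t := truncEnergy_nonneg hTlog hmono
  have hnn : 0 ≤ ∑' p : zstarOffDiag,
      truncWeight T p.1.1 * truncWeight T p.1.2 * interactionEnergy t p.1.1 p.1.2 :=
    tsum_nonneg fun p ↦ truncWeight_mul_interactionEnergy_nonneg hTlog t p
  have hTL : 0 ≤ T * Real.log T ^ 3 := by positivity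
  rw [abs_of_nonneg hnn]
  nlinarith

/-- **Rodgers–Tao 2020, Lemma 21 (i), printed witness form — CONTENT proof.** For `t₀ < 0` with
`H_{t₀}` real-rooted (the tree's witness rendering of the standing hypothesis `Λ ≤ t₀ < 0`),
conjunct (i) of `rodgers_tao_moderatelySized t₀` holds by the argument of this file (as opposed to
the ex-falso discharge `rodgers_tao_moderatelySized_holds`, which uses `Λ ≥ 0` to refute the
antecedent): `t₀ < t₀/2`, so the window lies above the real-rooted time `t₀` itself.
[cite: RodgersTaoFMP2020, Lemma 21 (i) p. 47 (= arXiv:1801.05914v4 Lemma 7.6 (i))] -/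
theorem rodgers_tao_moderatelySized_i_of_neg {t₀ : ℝ} (ht₀ : t₀ < 0)
    (hreal : HasOnlyRealZeros (deBruijnH t₀)) :
    IsModeratelySized t₀ (fun T t p ↦
      truncWeight T p.1.1 * truncWeight T p.1.2 * interactionEnergy t p.1.1 p.1.2) :=
  isModeratelySized_truncWeight_interactionEnergy ⟨t₀, by linarith, hreal⟩

end Literature.NumberTheory.LFunctions

end
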